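import Summits.FinalStateConjecture.FinalStateConjecture.Theorems.BartnikGapSettlingBondiBartnikRigidityStationaryKerrCollarRouteOriented
import Summits.FinalStateConjecture.FinalStateConjecture.Theorems.BartnikGapSettlingBondiBartnikRigiditySlabCauchyRigidityDefs
import HarnessLib

/-!
# K1a `stub_exactMinimiserKilling` — typed split into the unprinted Euler–Lagrange GERM (α) and printed
# Killing PROPAGATION (β') — line `direct-method-on-the-cone` (crux `BondiBartnikRigidity`,
# stmt-FinalStateConjecture-10807), lead c3, cycle 1 (rev 3: β corrected by worker beta, K1a ↦ K1a')

K1a (registered, skeleton rev 6): in a maximal vacuum development `𝒱` of ARBITRARY smooth data carrying ONE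
exact, future-oriented thick Kerr collar (exact `k'`-jet on the slab `{t* = 0, M < r ≤ 3M}`, cut energy,
Bondi–Bartnik gap `≤ 0`, at least one competitor) and the exact diamond chart `Ψ` of F1' (LANDED, p144449),
there is a Killing field `ξ` on the interior of the Killing domain `kD = D⁺(C ∪ N_out)` with
`ξ ∘ Ψ = dΨ(Λe₀)` on `Δ'`.

## Audit (lead c3)

* not junk-TRUE: the conclusion asks for a Killing field on ALL of `(kD)°`, which contains a one-sided future
  neighbourhood of the whole outer roof `N_out` (worker K2a, report `Lines/direct-method-on-the-cone-K2a-c3.md`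
  §A3 (w3)) — for data that are Kerr on the slab and perturbed outside `r > 3M` no such field exists; the
  hypotheses are `ξ`-free, so no `ξ ↦ −ξ` trick; the time-reversed witness is excluded by the orientation
  clauses; small/punctured data are excluded by `HasCutBondiMass` (reach, §A3 (w2) ibid.).
* not junk-FALSE as far as the tree can see: a counterexample must be CERTIFIED to have gap `≤ 0`
  (`BondiBartnikGapLE C 0`: some own cut energy `≤` every competitor mass `+ η`), i.e. it needs the infimum
  of the Bondi–Bartnik problem of the thick collar — Kerr-collar minimality (KCM), a Penrose-type inequality
  with rotation, OPEN (route review O1, refuter rattack).  Vacuity hazards recorded for the planner: (Q1) the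
  hypothesis `∃ m', IsCompetitorMass C m'` asks for an ADMISSIBLE (complete, one-ended, strongly AF, vacuum)
  datum containing the exact thick Kerr collar `{M < r ≤ 3M}` (which straddles `r₊` and is trapped near its
  inner edge) isometrically — plausible by interior gluing with the Kerr parameters absorbing the KID
  cokernel, NOT in print; (Q2) whether exact Kerr is itself a minimiser (KCM).  In the LIMIT CATEGORY the
  data manifold `X` is arbitrary, so own cut energies of exotic (non-AF) ends are not controlled by any
  positivity — a junk instance would need an explicit exotic vacuum end with an exact Kerr collar: none known.
* verdict: honest OPEN mathematics ("Bondi–Bartnik minimisers are stationary"; slice analogue: Bartnik-mass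
  minimisers carry KIDs — Huang–Lee 2020 Thm 10, Anderson–Jauregui 2019, An 2020; cone/Bondi version unprinted).

## The split

K1a ⟸ (α) `MinimiserKillingGerm` — the UNPRINTED core: an exact minimiser carries a Killing field on the part
of `(kD)°` near its "initial boundary" `C ∪ N_out` (intended proof: the cut energy is a functional
`𝔅[σ̂; Kerr jet at S₃]` of the FREE characteristic data `σ̂` of `N_out`; competitor REALISATION of nearby
`σ̂` (characteristic gluing, Aretakis–Czimek–Rodnianski / Kehle–Unger) turns `gap ≤ 0` into criticality
`d𝔅 = 0`; the Hamiltonian flux identity on `N_out` with corner at `S₃` turns criticality into the REDUCED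
CHARACTERISTIC KID EQUATIONS (Chruściel–Paetz 2013, (1.8)–(1.10)) for the candidate transported from the
Kerr jet; the characteristic KID theorem (ibid. Thm 1.2, two transverse null hypersurfaces / mixed
spacelike–null version) gives a Killing field on a one-sided neighbourhood of `C ∪ N_out` inside `D⁺`,
extending `dΨ(Λe₀)`), and
(β) `KillingPropagation` — PRINTED ingredients: `(kD)° = int D⁺(C ∪ N_out)` is globally hyperbolic with
Cauchy hypersurfaces inside any neighbourhood of `C ∪ N_out` (Hawking–Ellis 1973 Prop. 6.6.3, 6.6.7 — for
the faithful `futureDomain`), a field Killing near a Cauchy hypersurface of a vacuum globally hyperbolic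
region induces KIDs there and DEVELOPS into a Killing field of the region (Moncrief 1975 §III;
Fischer–Marsden–Moncrief 1980 Lemma 2.2; Coll 1977; tree: coordinate core `GaussSlice.exists_coordKilling_of_kid`
in `CoordKillingDevelopment.lean`), and two Killing fields agreeing on a non-empty open subset of a
connected open set agree on it (tree: `KillingOpensJetRigidity.lean`) — so the developed field still equals
`dΨ(Λe₀)` on the connected `Ψ(Δ')`.  Size: α XL/open; β L–XL (formalisation only).
The composition `stub_exactMinimiserKilling_of : α → β → K1a` below is checked.

References: Chruściel–Paetz, arXiv:1305.7468, Thm 1.2 [ChruscielPaetz2013KIDs]; Moncrief, J. Math. Phys. 16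
(1975) 493, §III [Moncrief1975]; Fischer–Marsden–Moncrief, Ann. IHP 33 (1980), Lemma 2.2; Hawking–Ellis 1973,
§6.6 [HawkingEllis1973CUP]; Huang–Lee, arXiv:2007.00593, Thm 10 [HuangLee2020]; Aretakis–Czimek–Rodnianski,
arXiv:2107.02441; Kehle–Unger, arXiv:2211.15742 [KehleUnger2024EventHorizonGluing].
## rev 3 (worker beta, wave 3 of lead c3): β was MIS-STATED, corrected to β'; K1a ↦ K1a'

The rev-2 β quantified over an ARBITRARY map `Φ 0` and point `p`, so `C = {p} ∪ Φ 0 '' slab` could be any set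
(an open ball gives `(kD)°` a timelike boundary and no Cauchy hypersurface) and the exact diamond `Ψ(Δ')` could
float free of the collar (then the developed field need not equal the anchor anywhere: axisymmetric two-region
sketch, report `work/stubs/beta/REPORT.md` §1).  β' = β + five hypotheses, all in scope where K1a is invoked:
`p ∈ Φ 0 '' slab`, the collar chart clause (C2) for `Φ 0`, `collarCore ⊆ range 𝒱.embed`, `Ψ = Φ 0` on the slab,
and F1''s continuity clause `ContinuousOn Ψ slabDiamondWithSlab'` — the last one is NEW for K1a, so the registered
stub becomes K1a' = K1a + that clause (skeleton rev 7, `stub_exactMinimiserKilling'`).  Paper proof of β' checked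
for the faithful `futureDomain` with non-closed `S` (past-set trick `P = G ∖ cl J⁺_G(G ∖ V)`), typed route G0–G5
(G2 = geometric Moncrief/FMM Killing development, XL or ONE named fact `fischerMarsdenMoncrief_killing_development`;
G1 needs Geroch/Bernal–Sánchez splitting as a named fact; G3 exact star charts push `Λe₀` to a Killing field, M;
G4 manifold Killing rigidity, S–M) in that report.
-/

noncomputable section

set_option linter.dupNamespace false
set_option maxSynthPendingDepth 3

open Set Filter Function Topology TopologicalSpace
open Literature.Geometry.Lorentzian
open Summit.FinalStateConjecture.FinalStateConjecture.Theorems.BondiBartnikRigidity.DirectMethod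
open scoped Manifold ContDiff Topology ENNReal

namespace Summit.FinalStateConjecture.FinalStateConjecture.Cruxes.BondiBartnikRigidity.DirectMethodOnTheCone

namespace K1aRoute

/-- verbatim the lead's `initialBoundary`. -/
def initialBoundary {X : Type} [TopologicalSpace X] [ChartedSpace E3 X] [IsManifold (𝓡 3) ∞ X]
    [ConnectedSpace X] {D : InitialDataSet (𝓡 3) X} (𝒱 : VacuumCauchyDevelopment D) (M : Fin 1 → ℝ)
    (p : 𝒱.carrier) (B : Fin 1 → ModelBackground) (Φ : ∀ i, (B i).domain → 𝒱.carrier) : Set 𝒱.carrier :=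
  collarCore M p B Φ ∪
    (frontier (𝒱.metric.causalFuture 𝒱.timeOrientation (collarCore M p B Φ)) ∩
      𝒱.metric.causalFuture 𝒱.timeOrientation (Φ 0 '' shellSlab (B 0) (M 0)))

/-- verbatim the lead's (α). -/
def MinimiserKillingGerm : Prop :=
  ∀ (k' : ℕ), 2 ≤ k' →
    ∀ (X : Type) [TopologicalSpace X] [ChartedSpace E3 X] [IsManifold (𝓡 3) ∞ X]
      [T2Space X] [SecondCountableTopology X] [ConnectedSpace X]
      (D : InitialDataSet (𝓡 3) X) (𝒱 : VacuumCauchyDevelopment D)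
      (M a : Fin 1 → ℝ) (p : 𝒱.carrier) (mo : Fin 1 → lorentzGroup × E4)
      (B : Fin 1 → ModelBackground) (Φ : ∀ i, (B i).domain → 𝒱.carrier)
      (Ψ : (B 0).domain → 𝒱.carrier),
    𝒱.IsMaximal → (∀ i, 0 < M i ∧ |a i| < M i) →
    (∃ i, p ∈ Φ i '' (B i).truncTimeSlab (3 * M i) 0) →
    collarCore M p B Φ ⊆ range 𝒱.embed →
    𝒱.NearKerrCollarCore k' 0 0 1 M a univ p mo B Φ →
    K2Route.CollarFutureOriented 𝒱 M mo B Φ → K2Route.CollarTimeOriented 𝒱 M a mo B Φ →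
    (∃ m' : ℝ, 𝒱.IsCompetitorMass (collarCore M p B Φ) m') →
    (∀ x ∈ (B 0).truncTimeSlab (3 * M 0) 0, Ψ x = Φ 0 x) →
    ContMDiffOn 𝓘(ℝ, E4) (𝓡 4) ∞ Ψ (F1Route.slabDiamond' (B 0) (M 0)) →
    IsOpenEmbedding ((F1Route.slabDiamond' (B 0) (M 0)).restrict Ψ) →
    Ψ '' F1Route.slabDiamond' (B 0) (M 0) ⊆ interior (killingDomain 𝒱 M p B Φ) →
    supCkENorm (Subtype.val '' F1Route.slabDiamond' (B 0) (M 0)) 0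
      (𝒱.toSpacetime.deviationExtend (B 0) Ψ) ≤ 0 →
    ∀ [𝒱.metric.toPseudoRiemannianMetric.HasLeviCivita],
    ∃ (V : Set 𝒱.carrier) (ξ : Π x : 𝒱.carrier, TangentSpace (𝓡 4) x),
      IsOpen V ∧ initialBoundary 𝒱 M p B Φ ⊆ V ∧
      𝒱.metric.IsKillingFieldOn ξ (interior (killingDomain 𝒱 M p B Φ) ∩ V) ∧
      (∃ x ∈ F1Route.slabDiamond' (B 0) (M 0), Ψ x ∈ V) ∧
      ∀ x ∈ F1Route.slabDiamond' (B 0) (M 0), Ψ x ∈ V →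
        ξ (Ψ x) = mfderiv 𝓘(ℝ, E4) (𝓡 4) Ψ x (((mo 0).1 : E4 ≃L[ℝ] E4) (E4.basisVector 0))

/-- **(β') `KillingPropagation'` — CORRECTED**: β with the three K1a hypotheses `p ∈ Φ 0 '' slab`,
(C2) for `Φ 0`, `collarCore ⊆ range 𝒱.embed` inserted after the star-background clause. -/
def KillingPropagation' : Prop :=
  ∀ (X : Type) [TopologicalSpace X] [ChartedSpace E3 X] [IsManifold (𝓡 3) ∞ X]
      [T2Space X] [SecondCountableTopology X] [ConnectedSpace X]
      (D : InitialDataSet (𝓡 3) X) (𝒱 : VacuumCauchyDevelopment D)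
      (M a : Fin 1 → ℝ) (p : 𝒱.carrier) (mo : Fin 1 → lorentzGroup × E4)
      (B : Fin 1 → ModelBackground) (Φ : ∀ i, (B i).domain → 𝒱.carrier)
      (Ψ : (B 0).domain → 𝒱.carrier) (V : Set 𝒱.carrier) (ξ : Π x : 𝒱.carrier, TangentSpace (𝓡 4) x),
    0 < M 0 → |a 0| < M 0 →
    B 0 = starBackground (mo 0).1 (mo 0).2 (M 0) (a 0)
      (fun x => Kerr.radius (a 0) (poincareInv (mo 0).1 (mo 0).2 x)) →
    p ∈ Φ 0 '' (B 0).truncTimeSlab (3 * M 0) 0 →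
    (ContMDiffOn 𝓘(ℝ, E4) (𝓡 4) ∞ (Φ 0)
        {x | -1 < (B 0).time x.1 ∧ (B 0).time x.1 < 1 ∧ (B 0).radius x.1 < 3 * M 0 + 1} ∧
      IsOpenEmbedding ({x | -1 < (B 0).time x.1 ∧ (B 0).time x.1 < 1 ∧
        (B 0).radius x.1 < 3 * M 0 + 1}.restrict (Φ 0))) →
    collarCore M p B Φ ⊆ range 𝒱.embed →
    (∀ x ∈ (B 0).truncTimeSlab (3 * M 0) 0, Ψ x = Φ 0 x) →
    ContinuousOn Ψ (F1Route.slabDiamondWithSlab' (B 0) (M 0)) →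
    ContMDiffOn 𝓘(ℝ, E4) (𝓡 4) ∞ Ψ (F1Route.slabDiamond' (B 0) (M 0)) →
    IsOpenEmbedding ((F1Route.slabDiamond' (B 0) (M 0)).restrict Ψ) →
    Ψ '' F1Route.slabDiamond' (B 0) (M 0) ⊆ interior (killingDomain 𝒱 M p B Φ) →
    supCkENorm (Subtype.val '' F1Route.slabDiamond' (B 0) (M 0)) 0
      (𝒱.toSpacetime.deviationExtend (B 0) Ψ) ≤ 0 →
    ∀ [𝒱.metric.toPseudoRiemannianMetric.HasLeviCivita],
    IsOpen V → initialBoundary 𝒱 M p B Φ ⊆ V →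
    𝒱.metric.IsKillingFieldOn ξ (interior (killingDomain 𝒱 M p B Φ) ∩ V) →
    (∃ x ∈ F1Route.slabDiamond' (B 0) (M 0), Ψ x ∈ V) →
    (∀ x ∈ F1Route.slabDiamond' (B 0) (M 0), Ψ x ∈ V →
        ξ (Ψ x) = mfderiv 𝓘(ℝ, E4) (𝓡 4) Ψ x (((mo 0).1 : E4 ≃L[ℝ] E4) (E4.basisVector 0))) →
    ∃ ξ' : Π x : 𝒱.carrier, TangentSpace (𝓡 4) x,
      𝒱.metric.IsKillingFieldOn ξ' (interior (killingDomain 𝒱 M p B Φ)) ∧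
      ∀ x ∈ F1Route.slabDiamond' (B 0) (M 0),
        ξ' (Ψ x) = mfderiv 𝓘(ℝ, E4) (𝓡 4) Ψ x (((mo 0).1 : E4 ≃L[ℝ] E4) (E4.basisVector 0))

end K1aRoute

/-- The corrected stub signature, written exactly as it would be registered (namespace
`…Theorems.BondiBartnikRigidity.DirectMethod` opened; `initialBoundary` unfolded). -/
theorem stub_killingPropagation_corrected_iff :
    K1aRoute.KillingPropagation' ↔
    ∀ (X : Type) [TopologicalSpace X] [ChartedSpace E3 X] [IsManifold (𝓡 3) ∞ X] [T2Space X] [SecondCountableTopology X] [ConnectedSpace X] (D : InitialDataSet (𝓡 3) X) (𝒱 : VacuumCauchyDevelopment D) (M a : Fin 1 → ℝ) (p : 𝒱.carrier) (mo : Fin 1 → lorentzGroup × E4) (B : Fin 1 → ModelBackground) (Φ : ∀ i, (B i).domain → 𝒱.carrier) (Ψ : (B 0).domain → 𝒱.carrier) (V : Set 𝒱.carrier) (ξ : Π x : 𝒱.carrier, TangentSpace (𝓡 4) x), 0 < M 0 → |a 0| < M 0 → B 0 = starBackground (mo 0).1 (mo 0).2 (M 0) (a 0) (fun x => Kerr.radius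 (a 0) (poincareInv (mo 0).1 (mo 0).2 x)) → p ∈ Φ 0 '' (B 0).truncTimeSlab (3 * M 0) 0 → (ContMDiffOn 𝓘(ℝ, E4) (𝓡 4) ∞ (Φ 0) {x | -1 < (B 0).time x.1 ∧ (B 0).time x.1 < 1 ∧ (B 0).radius x.1 < 3 * M 0 + 1} ∧ IsOpenEmbedding ({x | -1 < (B 0).time x.1 ∧ (B 0).time x.1 < 1 ∧ (B 0).radius x.1 < 3 * M 0 + 1}.restrict (Φ 0))) → collarCore M p B Φ ⊆ range 𝒱.embed → (∀ x ∈ (B 0).truncTimeSlab (3 * M 0) 0, Ψ x = Φ 0 x) → ContinuousOn Ψ (F1Route.slabDiamondWithSlab' (B 0) (M 0)) → ContMDiffOn 𝓘(ℝ, E4) (𝓡 4) ∞ Ψ (F1Route.slabDiamond' (B 0) (M 0)) → IsOpenEmbedding ((F1Route.slabDiamond' (B 0) (M 0)).restrict Ψ) → Ψ '' F1Route.slabDiamond' (B 0) (M 0) ⊆ interior (killingDomain 𝒱 M p B Φ) → supCkENorm (Subtype.val '' F1Route.slabDiamond' (B 0) (M 0)) 0 (𝒱.toSpacetime.deviationExtend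 (B 0) Ψ) ≤ 0 → ∀ [𝒱.metric.toPseudoRiemannianMetric.HasLeviCivita], IsOpen V → (collarCore M p B Φ ∪ (frontier (𝒱.metric.causalFuture 𝒱.timeOrientation (collarCore M p B Φ)) ∩ 𝒱.metric.causalFuture 𝒱.timeOrientation (Φ 0 '' shellSlab (B 0) (M 0)))) ⊆ V → 𝒱.metric.IsKillingFieldOn ξ (interior (killingDomain 𝒱 M p B Φ) ∩ V) → (∃ x ∈ F1Route.slabDiamond' (B 0) (M 0), Ψ x ∈ V) → (∀ x ∈ F1Route.slabDiamond' (B 0) (M 0), Ψ x ∈ V → ξ (Ψ x) = mfderiv 𝓘(ℝ, E4) (𝓡 4) Ψ x (((mo 0).1 : E4 ≃L[ℝ] E4) (E4.basisVector 0))) → ∃ ξ' : Π x : 𝒱.carrier, TangentSpace (𝓡 4) x, 𝒱.metric.IsKillingFieldOn ξ' (interior (killingDomain 𝒱 M p B Φ)) ∧ ∀ x ∈ F1Route.slabDiamond' (B 0) (M 0), ξ' (Ψ x) = mfderiv 𝓘(ℝ, E4) (𝓡 4) Ψ x (((mo 0).1 : E4 ≃L[ℝ] E4) (E4.basisVector 0))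 :=
  Iff.rfl

/-- **K1a' from (α) and the corrected (β')** — the lead's composition adapts once K1a gains the
F1' continuity clause `ContinuousOn Ψ (slabDiamondWithSlab' …)` (available as `hc` at the composition site
`exactMinimiserKerrnessOriented_of_stubs`): the new β-hypotheses come from `hp` (with `Fin 1`), `hcore`
((C2) for `i = 0`), `hCX`, `hΨΦ`, `hc`. -/
theorem stub_exactMinimiserKilling_of' (hα : K1aRoute.MinimiserKillingGerm)
    (hβ : K1aRoute.KillingPropagation') :
    ∀ (k' : ℕ), 2 ≤ k' →
    ∀ (X : Type) [TopologicalSpace X] [ChartedSpace E3 X] [IsManifold (𝓡 3) ∞ X]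
      [T2Space X] [SecondCountableTopology X] [ConnectedSpace X]
      (D : InitialDataSet (𝓡 3) X) (𝒱 : VacuumCauchyDevelopment D)
      (M a : Fin 1 → ℝ) (p : 𝒱.carrier) (mo : Fin 1 → lorentzGroup × E4)
      (B : Fin 1 → ModelBackground) (Φ : ∀ i, (B i).domain → 𝒱.carrier)
      (Ψ : (B 0).domain → 𝒱.carrier),
    𝒱.IsMaximal → (∀ i, 0 < M i ∧ |a i| < M i) →
    (∃ i, p ∈ Φ i '' (B i).truncTimeSlab (3 * M i) 0) →
    collarCore M p B Φ ⊆ range 𝒱.embed →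
    𝒱.NearKerrCollarCore k' 0 0 1 M a univ p mo B Φ →
    K2Route.CollarFutureOriented 𝒱 M mo B Φ → K2Route.CollarTimeOriented 𝒱 M a mo B Φ →
    (∃ m' : ℝ, 𝒱.IsCompetitorMass (collarCore M p B Φ) m') →
    (∀ x ∈ (B 0).truncTimeSlab (3 * M 0) 0, Ψ x = Φ 0 x) →
    ContinuousOn Ψ (F1Route.slabDiamondWithSlab' (B 0) (M 0)) →
    ContMDiffOn 𝓘(ℝ, E4) (𝓡 4) ∞ Ψ (F1Route.slabDiamond' (B 0) (M 0)) →
    IsOpenEmbedding ((F1Route.slabDiamond' (B 0) (M 0)).restrict Ψ) →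
    Ψ '' F1Route.slabDiamond' (B 0) (M 0) ⊆ interior (killingDomain 𝒱 M p B Φ) →
    supCkENorm (Subtype.val '' F1Route.slabDiamond' (B 0) (M 0)) 0
      (𝒱.toSpacetime.deviationExtend (B 0) Ψ) ≤ 0 →
    ∀ [𝒱.metric.toPseudoRiemannianMetric.HasLeviCivita],
    ∃ ξ : Π x : 𝒱.carrier, TangentSpace (𝓡 4) x,
      𝒱.metric.IsKillingFieldOn ξ (interior (killingDomain 𝒱 M p B Φ)) ∧
      ∀ x ∈ F1Route.slabDiamond' (B 0) (M 0),
        ξ (Ψ x) = mfderiv 𝓘(ℝ, E4) (𝓡 4) Ψ x (((mo 0).1 : E4 ≃L[ℝ] E4) (E4.basisVector 0)) := by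
  intro k' hk' X _ _ _ _ _ _ D 𝒱 M a p mo B Φ Ψ hmax hpar hp hCX hcore hfut htime hcomp hΨΦ hc hs he hJ hd _
  obtain ⟨V, ξ, hV, hSV, hξ, hne, hξΨ⟩ :=
    hα k' hk' X D 𝒱 M a p mo B Φ Ψ hmax hpar hp hCX hcore hfut htime hcomp hΨΦ hs he hJ hd
  have hp0 : p ∈ Φ 0 '' (B 0).truncTimeSlab (3 * M 0) 0 := by
    obtain ⟨i, hi⟩ := hp
    have : i = 0 := Subsingleton.elim _ _
    subst this
    exact hi
  exact hβ X D 𝒱 M a p mo B Φ Ψ V ξ (hpar 0).1 (hpar 0).2 (hcore.1 0) hp0 (hcore.2.1 0) hCX hΨΦ hc hs he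
    hJ hd hV hSV hξ hne hξΨ

end Summit.FinalStateConjecture.FinalStateConjecture.Cruxes.BondiBartnikRigidity.DirectMethodOnTheCone

end
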